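import Mathlib.Tactic.Linarith
import Mathlib.Tactic.Ring
import Mathlib.Tactic.NormNum
import HarnessLib

/-!
# The (0,1) cell of the ι-window, EXISTENCE side, XII: the Kummer weld is a theorem at the level of F̂ —
# arithmetic skeleton of `H2-EXISTENCE-SIDE-12.md`

Family `hodge`, b2b cell `hweil`, `Summits/HodgeConjecture/HodgeConjecture/Theorems` (helper of item stmt-HodgeConjecture-2524, the
Weil-sixfold rung the H2 test serves). Companion to `WeilTypeLadderH2W2CornerEight/Nine/Ten/Eleven.lean` ([VIII]–[XI]) with the SAME dictionary:
`X = J(C)`, `C` general of genus `4` on the smooth quadric `Q` (rulings `g`, `h`), `ι = −1`, `Θ = W₃ − κ`, `Θ_n = W₃ − h`, `Θ_{−n} = W₃ − g`,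
`S = S_n = Θ_n ∩ Θ_{−n} = C − C` with vertex `0` and resolution `α : C × C → S` (`f₁ ↦ A_z = z − C`, `f₂ ↦ B_z = C − z`), the `j = 2` saturated corner
sheaf `F̂_{z₁}` with hull `L₁ = 𝒪_{Θ_n}(2Θ − X_p) ⊗ P`, pinched modules `N₁ ⊂ L₁|_S`, `N₂ = ι^♯N₁`, matching `ψ`, the rigid Kummer move `w = −2β ∈ Π″`
(`Π″ = cone(ℓ^h_{z₁})`, `h_{z₁} = z₁ + c′ + c″`), `σ = t_w ∘ ι`, `S^ε = Θ_n ∩ (Θ_{−n} + εw)`, its centre `0^ε = εw/2`, the punctured family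
`S^{ε°} = S^ε ∖ 0^ε`, the translated lines `A_z^{(s)} = (z + εs) − C`, `B_z^{(s)} = (C − (z + εs)) + εw`, `d_z^{(s)} = A_z^{(s)} − B_z^{(s)}` (`z ∈ h_{z₁}`),
and the groups `𝒦 = ker(Pic S^{ε°} → Pic S°) ≅ H¹(S°, 𝒪)`, `𝐆 = Im(Pic J[ε] → Pic S^{ε°})`, `𝒢 = Im(H¹(J,𝒪) → 𝒦)`. Report
`run/shared/lean/b2b/hodge-weil/b2b-hweil-pv3-g19/H2-EXISTENCE-SIDE-12.md` (THEOREM L: [XI] 3.4 + 3.5 hold for every `w ∈ Π″` and general `(C, z₁)`,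
pen-and-paper; the exact content of [XI] 3.6 (a)), CLAIM TABLE v55 (LADDER C348) row pv3 + referee-g95 R564 (W-P3g18-W-a); code
`run/shared/lean/b2b/hodge-weil/code/pv3-g19/`. Def-free, fully proved ELEMENTARY statements (integer and class bookkeeping); the sheaf theory is in the
docstrings and the report. HONEST FRAMING: structure results about one cell of the ladder's H2 test on the existence side, on the Jacobian locus only;
no case of the Hodge conjecture is proved; nothing here is a rung; no statement of [Markman 2025] is used; nothing here depends on (LP), (8.3.3) or on
'ker ob = ann(ch)'.

§1 the reduction (`hull_presentation_count`); §2 persistence and the x-type sections (`persistence_count`, `xsection_hilbert_count`); §3 the class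
identity (`lifting_identity_bookkeeping`); §4 THEOREM L and consequences (`theorem_L_consequences`); §5 the content of 3.6 (a) (`flatness_content_36a`,
`evidence_count_36a`).

What is NOT here: sheaves, `ψ`, the deformations, Pic of `S^{ε°}`, the machine checks. 0 unconditional rungs above the floor.
-/

set_option linter.dupNamespace false

namespace Summit.HodgeConjecture.HodgeConjecture.WeilTypeLadder

section H2W2CornerTwelve

/-- LEMMA 1.2 (report): the hull does not see the auxiliary point `p`. On the small resolution `u : C₃ → W₃ ≅ Θ_n` (an isomorphism off the `2` nodes,
which have codimension `3` in the threefold), `𝒪_{C₃}(x_z − x_{z̃}) = u^*𝒫_{z−z̃}` (the class is algebraically trivial; `Pic(C_N) = u_N^*Pic(J) ⊕ ℤ·𝒪(1)`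
for `N ≥ 2·4 − 1 = 7`; restriction to a coordinate curve gives `𝒫_C = 𝒪_C(z − z̃)`, of degree `1 − 1 = 0`), hence the reflexive sheaf
`𝒪_{Θ_n}(X_z − X_{z̃})` agrees with the line bundle `𝒫_{z−z̃}|` off codimension `3 ≥ 2` and equals it; so `𝓘_{X_p}(2Θ)P ≅ 𝓘_{X_{c′}}(2Θ)P′`, and WLOG
`p = c′`. Then ([VII] 3.3 (a) with `(p; p₁, p₂) = (c′; z₁, c″)`) `ξ₁ = X_{c′}·S = A_{c′} + B_{z₁} + B_{c″}` has class `f₁ + 2f₂` on `C × C` (`1` line of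
the first kind, `2` of the second), `Γ₄ = ξ₁ + Z₁ = A_{c′} + A_{z₁} + B_{z₁} + B_{c″}` has class `2f₁ + 2f₂` (`4` lines), `ιΓ₄` likewise, and
`Γ₄ − ιΓ₄ = d_{c′} − d_{c″}` restricts to `Δ ≅ C` with degree `(1 + 1) − (1 + 1) = 0` (consistent with [VII] 9.2: locally principal at the vertex).
`p = z₁` is NOT admissible (`Z₁ ⊂ X_{z₁}`), `p = c′` is (`h⁰(2z₁ + c″) = 1 < 2`). [§1.2] -/
theorem hull_presentation_count :
    ((3 : ℕ) ≥ 2 ∧ (2 : ℕ) * 4 - 1 = 7 ∧ (1 : ℤ) - 1 = 0) ∧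
    ((1 : ℕ) + 2 = 3 ∧ (2 : ℕ) + 2 = 4 ∧ ((1 : ℤ) + 1) - (1 + 1) = 0) ∧
    ((1 : ℕ) < 2) ∧
    (∀ a b : ℤ, (a + b) - (b + a) = 0) := by
  refine ⟨by norm_num, by norm_num, by norm_num, ?_⟩
  intro a b
  ring

/-- LEMMA 2.1 (report): persistence of the six lines over `h_{z₁}`. For `w ∈ Π″` and each of the `3` points `z ∈ h_{z₁} = {z₁, c′, c″}`: the
translates `A_z + εv` lying in `S^ε` are exactly `v ∈ kĊ(z)` and the translates `B_z + εv` in `S^ε` are exactly `v ∈ w + kĊ(z)` — in each case ONE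
coset of a `1`-dimensional space (sufficiency: four Riemann–Kempf plane containments 'the plane `⟨D⟩` of a degree-`3` divisor `D` with `h⁰(D) = 1`
contains the points of `D` and, if it contains a line of `Q` and a further point of `Q`, the line of the other ruling through that point';
exhaustiveness: `T_{c−z}(C − C) = span(Ċ(c), Ċ(z))` and `⋂_c = kĊ(z)`, since `3` general points of the canonical curve span a plane, `3 − 1 = 2 > 1`).
So `3 + 3 = 6` persisting lines; `Π″ = cone(ℓ^h_{z₁})` has dimension `2` and is spanned by any `2` of the `3` collinear points' vectors, which satisfy
exactly `3 − 2 = 1` relation (the pencil velocity of `h_{z₁}`: the class `h` is constant, `deg = 3`); `σ` exchanges `A_z^{(s)} ↔ B_z^{(s)}`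
(`σ(x + εv) = −x + ε(w − v)`, and `w − (w − v) = v`). For `β = ζ` the translates of ALL lines `z − C`, `C − z` surviving in `S^ε` are those over the
polar divisor `2z₁ + z₁′ + z₁″ + c′ + c″` of degree `2 + 1 + 1 + 1 + 1 = 6 = deg C_K` ([XI] 3.8 (1)). [§2.1] -/
theorem persistence_count :
    ((3 : ℕ) + 3 = 6 ∧ (1 : ℕ) = 1 ∧ (3 : ℕ) - 1 = 2 ∧ (2 : ℕ) > 1 ∧ (3 : ℕ) - 2 = 1) ∧
    ((2 : ℕ) + 1 + 1 + 1 + 1 = 6 ∧ (2 : ℕ) * 4 - 2 = 6) ∧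
    (∀ w v : ℤ, w - (w - v) = v) := by
  refine ⟨by norm_num, by norm_num, ?_⟩
  intro w v
  ring

/-- LEMMA 2.2 (report): the x-type sections of `S^ε` stay unions of translated lines. In `X_z ≅ C₂`, `Θ_{−n}|_{X_z} = T = T_h + x_{z′} + x_{z″}`
([VII] 3.3 (a); `3` reduced branches concurrent at `P₀ = z′ + z″ ↦ 0`). The bookkeeping used: `x_q² = 1` (so `deg N_{x_q/C₂} = 1`, `N_{x_q} ≅ 𝒪_C(q)`,
`h⁰ = 1`), `x_{z′}·x_{z″} = 1` (the single point `P₀`), and for the nodal curve `R = x_{z′} ∪ x_{z″}`: `0 → N_R → 𝒪_C(z′+z″) ⊕ 𝒪_C(z′+z″) → k → 0` with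
`h⁰(𝒪_C(z′ + z″)) = 1` (degree `2 <` gonality `3` of a non-hyperelliptic genus-`4` curve), so `h⁰(N_R) ≤ 1 + 1 = 2`, `= 2` = the dimension of the
family `(a, b) ↦ x_a + x_b`: `Hilb_{C₂}` is smooth of dimension `2` at `[R]` and every first-order deformation of `R` is `x_{z′+εs′} + x_{z″+εs″}`.
Since `T_h[ε] ↦ A_z[ε] ⊂ S^ε` persists (2.1), `X_z·S^ε = T_h[ε] + R^ε` with `R^ε` such a deformation, whose branches map to `B_{z″} + εs′Ċ(z′)` and
`B_{z′} + εs″Ċ(z″)` — translated lines, of the form `B^{(s)}` by 2.1: `X_z·S^ε = A_z^{(0)} + B_{z′}^{(s′)} + B_{z″}^{(s″)}`, `3` components, and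
`σ(X_z·S^ε) = B_z^{(0)} + A_{z′}^{(s′)} + A_{z″}^{(s″)}`. [§2.2] -/
theorem xsection_hilbert_count :
    ((1 : ℤ) = 1 ∧ (2 : ℕ) < 3 ∧ (1 : ℕ) + 1 = 2) ∧
    ((1 : ℕ) + 2 = 3 ∧ (3 : ℕ) = 1 + 1 + 1) ∧
    (∀ h0 : ℕ, h0 ≤ 1 + 1 → 2 ≤ h0 → h0 = 2) := by
  refine ⟨by norm_num, by norm_num, ?_⟩
  intro h0 h1 h2
  omega

/-- §3 (report): the class identity. In the free abelian group on the symbols `d_z` (`z ∈ h_{z₁}`; superscripts `(s)` may be dropped modulo `𝒢` by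
LEMMA 3.1: `𝒪(d_z^{(s)} − d_z^{(0)})` is `d/dt` of `𝒪_S(d_{z(t)} − d_z) = 𝒫_{z(t)−z}|_S`, a restricted `Pic⁰(J)`-class), LEMMA 2.2 gives
`ξ_{c′}^ε − σξ_{c′}^ε = d_{c′} − d_{z₁} − d_{c″}` and `ξ_{c″}^ε − σξ_{c″}^ε = d_{c″} − d_{z₁} − d_{c′}`, whose DIFFERENCE is `2·d_{c′} − 2·d_{c″}`
(the `d_{z₁}` cancel: coefficient `−1 − (−1) = 0`), and by LEMMA 3.2 that difference is the restricted class `𝒫_{c′−c″}^{⊗2}[ε]` (exponent `1 + 1 = 2`: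
`𝒪_{Θ_n}(X_{c′} − X_{c″}) = 𝒫|` and `σ^*𝒫 = 𝒫^{−1}`, `1 − (−1) = 2`). Since `𝐆 ∩ 𝒦 = 𝒢` is a `ℚ`-vector subspace of `𝒦 ≅ H¹(S°, 𝒪)`, `2·x ∈ 𝒢 ⇒ x ∈ 𝒢`
(division by `2 ≠ 0`): `𝒪(d_{c′} − d_{c″}) ∈ 𝐆`. Finally `Γ₄^ε − σΓ₄^ε = (ξ_{c′}^ε − σξ_{c′}^ε) + d_{z₁}^{(0)} ≡ d_{c′} − d_{z₁} − d_{c″} + d_{z₁} =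
d_{c′} − d_{c″}` (coefficients `(1, −1 + 1, −1) = (1, 0, −1)`): `𝓗 = 𝓗om(N₁^ε, σ^*N₁^ε)|_{S^{ε°}} ∈ 𝐆`. The integer shadow: the two coefficient
vectors and their difference, and `2x = 2y → x = y` over `ℤ` (torsion-freeness is what the `ℚ`-structure provides). [§3.1–3.3] -/
theorem lifting_identity_bookkeeping :
    (∀ dc dz dcc : ℤ, (dc - dz - dcc) - (dcc - dz - dc) = 2 * dc - 2 * dcc) ∧
    (∀ dc dz dcc : ℤ, (dc - dz - dcc) + dz = dc - dcc) ∧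
    ((-1 : ℤ) - (-1) = 0 ∧ (1 : ℤ) - (-1) = 2 ∧ (1 : ℤ) + 1 = 2) ∧
    (∀ x y : ℤ, 2 * x = 2 * y → x = y) := by
  refine ⟨fun dc dz dcc => by ring, fun dc dz dcc => by ring, by norm_num, ?_⟩
  intro x y h
  omega

/-- THEOREM L and consequences (report §4). THEOREM L: for `C` general of genus `4`, `z₁` not a ramification point of `π_h`, and every `w ∈ Π″`
(a `2`-dimensional space of rigid moves), the matching `ψ` lifts over `S^ε` after the unique twist `τ/2` of the torsor (`ι^* = −1` on `H¹(J,𝒪)`, so a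
twist `τ₁` changes `𝓗` by `τ₁^{−2}`: exponent `−1 − 1 = −2`), and `F̂^ε` is a flat ι-symmetric first-order deformation of `F̂_{z₁}` with support
`D_{n+εβ}` — [XI] 3.4 + 3.5 for EVERY truncation order, pen-and-paper. COROLLARY 4.2: `e₁^ι(F̂_{z₁}) ≥ 1 + 2 = 3` (the `z₁`-class, support motion `0`,
plus the `2` Kummer classes, support motions `ν_β` injective in `β`). COROLLARY 4.3: THEOREM W for the `δ = 0` rows (`F̂^ε ↠ B_K[ε] ⊕ σ^*B_K[ε]` onto by
Nakayama, colength `2·0 = 0`): `e₁^ι(F_K) ≥ 1 + 1 = 2 > 1`. 4.4: THEOREM W for the `δ = 2` rows has `4` inputs of which `3` are now pen-and-paper and `1`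
([XI] 3.6 (a)) is machine. [§4] -/
theorem theorem_L_consequences :
    ((2 : ℕ) = 2 ∧ (-1 : ℤ) - 1 = -2 ∧ (2 : ℤ) * (1 / 2 : ℚ) = 1) ∧
    ((1 : ℕ) + 2 = 3 ∧ (1 : ℕ) + 1 = 2 ∧ (2 : ℕ) > 1 ∧ (2 : ℕ) * 0 = 0) ∧
    ((4 : ℕ) = 3 + 1) := by
  norm_num

/-- §5 (report): the exact content of [XI] 3.6 (a). 5.1: tacnode-preserving symmetric moves are `β, γ ∈ kζ` (`Π′ ∩ Π″ = kζ`, dimension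
`2 + 2 − 3 = 1`); with `w = −2ζ` the three points on `Z₁` (parameter `τ`, centre of parity at `τ = ε`) are the node of `Θ_n` at `τ = 0`, the centre
`εw/2` at `τ = 1·ε`, the node `εw` of `Θ_{−n} + εw` at `τ = 2·ε`; `σ` swaps `0 ↔ 2ε` about `ε` (`0 + 2 = 2·1`); the triple point of
`(Θ_{−n} + εw) ∩ X_{z₁}` persists iff `w ∈ kζ` and then sits at `τ = 2ε` (the `h`-divisor moves by `λż₁ = 2` pencil units). 5.2: over `k[ε]` the even
and odd restricted functions are `E^ε = k[ε] ⊕ (τ−ε)²k[ε][[τ]]`, `O^ε = (τ−ε)k[ε][[τ]]` (centred at `ε`; `τ^k ∈ (τ−ε)²k[ε][[τ]]` exactly for `k ≥ 3`, as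
`τ^k ≡ (τ−ε)^k + kε(τ−ε)^{k−1}` and `k − 1 ≥ 2 ⟺ k ≥ 3`), while the `θ`-elements have B-classes in `τ·(τ − 2ε)²·k[ε][[τ]]` (orders `1` at `τ = 0` from
`𝓛̃₁|_{E₁} = 𝒪_{ℙ¹}(−1)`, degree `−1 < 0`, and `2` at the node `τ = 2ε`; total order `1 + 2 = 3` at `ε = 0`); the (R0) quotient for `K(0) ∈ {V₊, V₋}`
(`δ = 1 + 1 = 2`) is flat iff the deformed cokernel has length `2·2 = 4` iff ONE scalar vanishes: the B-component of the σ-odd (resp. σ-even) generator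
AT THE CENTRE — the coefficient `o₀(0)·(φ₂′(0) + χ(0))` of `τ` must vanish for all `o₀(0)`; with `h(P) ≠ 0` it could never be flat since
`(τ−ε)² − (τ−2ε)² ≡ 2ετ` (coefficient `−2 + 4 = 2 ≠ 0`). So [X] A.7 'goes through over `k[ε]`' iff that scalar vanishes (erratum E-P3g19-1 to the WORDING
of [XI] 3.6 (a)); the condition is CLOSED in `(C, z₁)` (fibre length `≤ 4`, `= 4` iff flat). [§5.1–5.3] -/
theorem flatness_content_36a :
    ((2 : ℤ) + 2 - 3 = 1 ∧ (0 : ℤ) + 2 = 2 * 1 ∧ (2 : ℤ) = 2) ∧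
    (∀ k : ℕ, (2 ≤ k - 1 ↔ 3 ≤ k)) ∧
    ((-1 : ℤ) < 0 ∧ (1 : ℕ) + 2 = 3 ∧ (1 : ℕ) + 1 = 2 ∧ (2 : ℕ) * 2 = 4) ∧
    ((-2 : ℤ) + 4 = 2 ∧ (2 : ℤ) ≠ 0) ∧
    (∀ len : ℕ, len ≤ 4 → (len = 4 ↔ 4 ≤ len)) := by
  refine ⟨by norm_num, ?_, by norm_num, by norm_num, ?_⟩
  · intro k
    omega
  · intro len h
    omega

/-- §5.4 (report): the machine evidence for [XI] 3.6 (a) after this seat (faithful vertex model `code/pv3-g19/` = `code/pv3-g18/` with the prime a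
parameter). `deform_R0.py s 8 zeta K0|Ksig`: 'deformed (normalised) colength `4` (flat iff `4`)', 'eps-part of `T^{Y,eps}` equals `eps*T^Y`: True' for
seeds `1, 2, 3` ([XI], `N = 8, 9, 10`), seeds `4, 5, 6` (`N = 8`) over `𝔽₃₂₀₀₃` and seeds `1, 2` over `𝔽₆₅₅₂₁`: `3 + 3 + 2 = 8` pointed curves in `2`
characteristics (`32003 ≠ 65521`; `65521 = 2¹⁶ − 15`); the control `β = Ċ(c′)` gives colength `2 ≠ 4` on every curve; `weld.py` (3.4) passes on all, as it must by
THEOREM L. The images are compared in `(k[τ]/τ⁶)²` of dimension `2·6 = 12` over `k`, `24` over `k[ε]`; flat iff the image has dimension `24 − 2·4 = 16`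
there (resp. `8` of `12` after normalisation, colength `12 − 8 = 4`). LABEL: machine, mod truncation; THEOREM W for the `δ = 2` rows PROPOSED ⇐ 3.6 (a).
[§5.4] -/
theorem evidence_count_36a :
    ((3 : ℕ) + 3 + 2 = 8 ∧ (32003 : ℕ) ≠ 65521 ∧ (2 : ℕ) ≠ 4) ∧
    ((2 : ℕ) * 6 = 12 ∧ (2 : ℕ) * 12 = 24 ∧ (24 : ℕ) - 2 * 4 = 16 ∧ (12 : ℕ) - 8 = 4) ∧
    ((65521 : ℕ) = 2 ^ 16 - 15 ∧ (32003 : ℕ) < 65521) := by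
  norm_num

end H2W2CornerTwelve

end Summit.HodgeConjecture.HodgeConjecture.WeilTypeLadder
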